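import Mathlib
import HarnessLib
import Summits.Ventures.LatticeQCDFlow.Scaling.TorusRankedParityBound

/-!
# LatticeQCDFlow / Scaling — signed plaquette boundaries of `(ℤ/L)^d` over `ℤ`: top-link pivots,
# zero divergence, zero winding

HONEST FRAMING: exact (Metropolis-corrected) sampling algorithms for lattice gauge theory;
figures of merit are autocorrelation/cost numbers at stated couplings and volumes; no
continuum-physics claim.

Venture `LatticeQCDFlow` (cell pub-lqcd), topic `Scaling`, FANOUT row 30 (lean-1, GEN-27) — OUR WORK on
THEORY-2.md §4 row C5 (gen25 Q2, the ℤ-COEFFICIENT DETERMINATION, part 1 of 2; part 2 is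
`Scaling/TorusRankedIntegerSpan`).  A collection `B` of plaquettes of `(ℤ/L)^d` RANKED for a top-link
assignment `t` (`t p` a link of `p`; `rank p < rank p'` whenever `t p` lies on another `p' ∈ B`) carries an
exact one-plaquette heat-bath autoregression (`Scaling/AutoregressiveGaugeHeatBathRanked`).
`TorusRankedParityBound` ∕ `TorusRankedHomologyBound` ∕ `TorusCellularHomologyOne` did the linear algebra of
plaquette boundaries over `ℤ/2`; an abelian gauge field sees INTEGER coefficients
(`U_p = U(x,i) U(x+e_i,j) U(x+e_j,i)⁻¹ U(x,j)⁻¹`), so here the signed objects over `ℤ` (and any ring):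

* §1 the SIGNED boundary `σ∂p = 𝟙_{(x,i)} + 𝟙_{(x+e_i,j)} − 𝟙_{(x+e_j,i)} − 𝟙_{(x,j)}` of `p = (x; i<j)` over
  any ring (four `Pi.single`s): off the plaquette it vanishes, on it it squares to `1` (`L ≥ 2`), and mod `2`
  it is the boundary vector of `TorusRankedParityBound`; **`eq_zero_of_sum_smul_signedBoundary_apply_top`** —
  a combination `Σ_{p∈B} g_p σ∂p` over a ranked `B` that vanishes at every top link has `g = 0` on `B`
  (evaluate at the top link of the maximal-rank plaquette with `g_p ≠ 0`: a `±1` pivot and no other term);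
* §2 the signed DIVERGENCE `f ↦ (y ↦ Σ_i (f(y,i) − f(y−e_i,i)))` and the signed WINDING
  `f ↦ (m ↦ Σ_{x : x_m = 0} f(x,m))` over `ℤ` are linear, a single link `𝟙_{(x,i)}` goes to `𝟙_x − 𝟙_{x+e_i}`
  resp. `[x_i = 0]·𝟙_i`, and both KILL EVERY SIGNED BOUNDARY (**`intDivergence_signedBoundary`**,
  **`intWinding_signedBoundary`**); mod `2` they are the vertex parity and the winding of the `ℤ/2` files
  (**`intCast_intDivergence`**, **`intCast_intWinding`**);
* §3 bookkeeping: **`card_eq_of_card_compl_eq_kmin`** — an OPTIMAL ranked structure (`#Bᶜ = k_min(d, L) =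
  (d−1)(d−2)/2·L^d + (d−1)`, `TorusRankedMorseCount.isLeast_card_compl_ranked`) is FULL: `#B = (d−1)(L^d − 1)`.

No `def` (chains, boundaries and functionals are spelled out as terms), no `sorry`, nothing cited as a fact
beyond the tree.
-/

namespace Summit.Ventures.LatticeQCDFlow.Theory2.Autoregressive

open Finset
open Literature.MathematicalPhysics.QuantumFieldTheory

variable {d L : ℕ} [NeZero L]

/-! ## §1 Signed boundaries -/

section Signed

variable {R : Type*} [Ring R]

omit [NeZero L] in
/-- Off the plaquette the signed boundary `𝟙_{(x,i)} + 𝟙_{(x+e_i,j)} − 𝟙_{(x+e_j,i)} − 𝟙_{(x,j)}` vanishes.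
[ours] -/
theorem signedBoundary_apply_of_notMem (p : Plaquette d L) {e : Edge d L}
    (he : e ∉ ({(p.1, p.2.1.1), (p.1.shift p.2.1.1, p.2.1.2), (p.1.shift p.2.1.2, p.2.1.1), (p.1, p.2.1.2)} :
      Finset (Edge d L))) :
    ((Pi.single (p.1, p.2.1.1) 1 + Pi.single (p.1.shift p.2.1.1, p.2.1.2) 1 -
        Pi.single (p.1.shift p.2.1.2, p.2.1.1) 1 - Pi.single (p.1, p.2.1.2) 1 : Edge d L → R) e) = 0 := by
  simp only [Finset.mem_insert, Finset.mem_singleton, not_or] at he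
  obtain ⟨h1, h2, h3, h4⟩ := he
  simp [h1, h2, h3, h4]

omit [NeZero L] in
/-- On each of its four links (`L ≥ 2`: they are pairwise distinct) the signed boundary is `±1`: its square
is `1`. [ours] -/
theorem signedBoundary_apply_mul_self_of_mem (hL : 2 ≤ L) (p : Plaquette d L) {e : Edge d L}
    (he : e ∈ ({(p.1, p.2.1.1), (p.1.shift p.2.1.1, p.2.1.2), (p.1.shift p.2.1.2, p.2.1.1), (p.1, p.2.1.2)} :
      Finset (Edge d L))) :
    ((Pi.single (p.1, p.2.1.1) 1 + Pi.single (p.1.shift p.2.1.1, p.2.1.2) 1 -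
        Pi.single (p.1.shift p.2.1.2, p.2.1.1) 1 - Pi.single (p.1, p.2.1.2) 1 : Edge d L → R) e) *
      ((Pi.single (p.1, p.2.1.1) 1 + Pi.single (p.1.shift p.2.1.1, p.2.1.2) 1 -
        Pi.single (p.1.shift p.2.1.2, p.2.1.1) 1 - Pi.single (p.1, p.2.1.2) 1 : Edge d L → R) e) = 1 := by
  obtain ⟨x, ⟨⟨i, j⟩, hij⟩⟩ := p
  have hij' : i ≠ j := ne_of_lt hij
  have hsi : x.shift i ≠ x := site_shift_ne hL x i
  have hsj : x.shift j ≠ x := site_shift_ne hL x j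
  have n12 : ((x, i) : Edge d L) ≠ (x.shift i, j) := fun h => hij' (congrArg Prod.snd h)
  have n13 : ((x, i) : Edge d L) ≠ (x.shift j, i) := fun h => hsj (congrArg Prod.fst h).symm
  have n14 : ((x, i) : Edge d L) ≠ (x, j) := fun h => hij' (congrArg Prod.snd h)
  have n23 : ((x.shift i, j) : Edge d L) ≠ (x.shift j, i) := fun h => hij' (congrArg Prod.snd h).symm
  have n24 : ((x.shift i, j) : Edge d L) ≠ (x, j) := fun h => hsi (congrArg Prod.fst h)
  have n34 : ((x.shift j, i) : Edge d L) ≠ (x, j) := fun h => hij' (congrArg Prod.snd h)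
  simp only [Finset.mem_insert, Finset.mem_singleton] at he
  simp only at he ⊢
  rcases he with rfl | rfl | rfl | rfl
  · simp [n12, n13, n14]
  · simp [n12.symm, n23, n24]
  · simp [n13.symm, n23.symm, n34]
  · simp [n14.symm, n24.symm, n34.symm]

omit [NeZero L] in
/-- Mod `2` the signed boundary over `ℤ` is the boundary vector of `TorusRankedParityBound`. [ours] -/
theorem intCast_signedBoundary_apply (p : Plaquette d L) (e : Edge d L) :
    (((Pi.single (p.1, p.2.1.1) 1 + Pi.single (p.1.shift p.2.1.1, p.2.1.2) 1 -
        Pi.single (p.1.shift p.2.1.2, p.2.1.1) 1 - Pi.single (p.1, p.2.1.2) 1 : Edge d L → ℤ) e : ℤ) : ZMod 2) =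
      (Pi.single (p.1, p.2.1.1) 1 + Pi.single (p.1.shift p.2.1.1, p.2.1.2) 1 +
        Pi.single (p.1.shift p.2.1.2, p.2.1.1) 1 + Pi.single (p.1, p.2.1.2) 1 : Edge d L → ZMod 2) e := by
  classical
  simp only [Pi.add_apply, Pi.sub_apply, Pi.single_apply, Int.cast_add, Int.cast_sub, Int.cast_ite,
    Int.cast_one, Int.cast_zero]
  simp only [sub_eq_add_neg, ZMod.neg_eq_self_mod_two]

omit [NeZero L] in
/-- Over `ℤ/2` the signed boundary IS the boundary vector (`−1 = 1`). [ours] -/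
theorem signedBoundary_zmod_two_eq (p : Plaquette d L) :
    (Pi.single (p.1, p.2.1.1) 1 + Pi.single (p.1.shift p.2.1.1, p.2.1.2) 1 -
        Pi.single (p.1.shift p.2.1.2, p.2.1.1) 1 - Pi.single (p.1, p.2.1.2) 1 : Edge d L → ZMod 2) =
      (Pi.single (p.1, p.2.1.1) 1 + Pi.single (p.1.shift p.2.1.1, p.2.1.2) 1 +
        Pi.single (p.1.shift p.2.1.2, p.2.1.1) 1 + Pi.single (p.1, p.2.1.2) 1 : Edge d L → ZMod 2) := by
  ext e
  simp only [Pi.add_apply, Pi.sub_apply, Pi.neg_apply, sub_eq_add_neg, ZMod.neg_eq_self_mod_two]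

omit [NeZero L] in
/-- **The top-link pivots.**  `L ≥ 2`; `(B, t, rank)` ranked.  If the combination `Σ_{p∈B} g_p σ∂p` vanishes
at every top link `t p`, `p ∈ B`, then `g_p = 0` for every `p ∈ B`: at the top link of the maximal-rank
plaquette with `g_p ≠ 0` no other term survives, and the pivot is `±1`. [ours] -/
theorem eq_zero_of_sum_smul_signedBoundary_apply_top (hL : 2 ≤ L) (B : Finset (Plaquette d L))
    (t : Plaquette d L → Edge d L)
    (ht : ∀ p ∈ B, t p ∈ ({(p.1, p.2.1.1), (p.1.shift p.2.1.1, p.2.1.2),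
        (p.1.shift p.2.1.2, p.2.1.1), (p.1, p.2.1.2)} : Finset (Edge d L)))
    (rank : Plaquette d L → ℕ)
    (hrank : ∀ p ∈ B, ∀ p' ∈ B, p ≠ p' → t p ∈ ({(p'.1, p'.2.1.1), (p'.1.shift p'.2.1.1, p'.2.1.2),
        (p'.1.shift p'.2.1.2, p'.2.1.1), (p'.1, p'.2.1.2)} : Finset (Edge d L)) → rank p < rank p')
    (g : Plaquette d L → R)
    (hzero : ∀ p ∈ B, (∑ p' ∈ B, g p' • (Pi.single (p'.1, p'.2.1.1) 1 +
        Pi.single (p'.1.shift p'.2.1.1, p'.2.1.2) 1 - Pi.single (p'.1.shift p'.2.1.2, p'.2.1.1) 1 -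
        Pi.single (p'.1, p'.2.1.2) 1 : Edge d L → R)) (t p) = 0) :
    ∀ p ∈ B, g p = 0 := by
  classical
  by_contra hne
  push Not at hne
  obtain ⟨p₀, hp₀, hg₀⟩ := hne
  set S : Finset (Plaquette d L) := B.filter (fun p => g p ≠ 0) with hS
  have hSne : S.Nonempty := ⟨p₀, by simp [hS, hp₀, hg₀]⟩
  obtain ⟨m, hmS, hmax⟩ := S.exists_max_image rank hSne
  have hmB : m ∈ B := (Finset.mem_filter.1 hmS).1
  have hgm : g m ≠ 0 := (Finset.mem_filter.1 hmS).2
  have heval := hzero m hmB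
  rw [Finset.sum_apply, Finset.sum_eq_single m] at heval
  · rw [Pi.smul_apply, smul_eq_mul] at heval
    have h2 := congrArg (fun r => r * ((Pi.single (m.1, m.2.1.1) 1 + Pi.single (m.1.shift m.2.1.1, m.2.1.2) 1 -
        Pi.single (m.1.shift m.2.1.2, m.2.1.1) 1 - Pi.single (m.1, m.2.1.2) 1 : Edge d L → R) (t m))) heval
    simp only [zero_mul, mul_assoc, signedBoundary_apply_mul_self_of_mem hL m (ht m hmB), mul_one] at h2
    exact hgm h2
  · intro p' hp' hne'
    by_cases hgp : g p' = 0
    · rw [Pi.smul_apply, hgp, zero_smul]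
    · have hp'S : p' ∈ S := Finset.mem_filter.2 ⟨hp', hgp⟩
      have hle := hmax p' hp'S
      have hnot : t m ∉ ({(p'.1, p'.2.1.1), (p'.1.shift p'.2.1.1, p'.2.1.2),
          (p'.1.shift p'.2.1.2, p'.2.1.1), (p'.1, p'.2.1.2)} : Finset (Edge d L)) := by
        intro hmem
        have := hrank m hmB p' hp' (fun h => hne' h.symm) hmem
        omega
      rw [Pi.smul_apply, signedBoundary_apply_of_notMem p' hnot, smul_zero]
  · intro h; exact absurd hmB h

end Signed

/-! ## §2 Signed divergence and winding over `ℤ` -/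

omit [NeZero L] in
/-- The signed divergence `f ↦ (y ↦ Σ_i (f(y,i) − f(y−e_i,i)))` is `ℤ`-linear. [ours] -/
theorem intDivergence_isLinear :
    IsLinearMap ℤ (fun f : Edge d L → ℤ =>
      fun y : Site d L => ∑ i : Fin d, (f (y, i) - f (y - Pi.single i 1, i))) := by
  constructor
  · intro f g; ext y
    simp only [Pi.add_apply, ← Finset.sum_add_distrib]
    exact Finset.sum_congr rfl fun i _ => by ring
  · intro c f; ext y
    simp only [Pi.smul_apply, smul_eq_mul, Finset.mul_sum, mul_sub]

omit [NeZero L] in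
/-- The signed divergence of a single link `𝟙_{(x,i)}` is `𝟙_x − 𝟙_{x+e_i}`. [ours] -/
theorem intDivergence_single (x : Site d L) (i : Fin d) :
    (fun y : Site d L => ∑ k : Fin d,
        ((Pi.single (x, i) 1 : Edge d L → ℤ) (y, k) - (Pi.single (x, i) 1 : Edge d L → ℤ) (y - Pi.single k 1, k))) =
      (Pi.single x 1 - Pi.single (x.shift i) 1 : Site d L → ℤ) := by
  classical
  ext y
  have h1 : ∑ k : Fin d, (Pi.single (x, i) 1 : Edge d L → ℤ) (y, k) = (Pi.single x 1 : Site d L → ℤ) y := by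
    rw [Finset.sum_eq_single i]
    · by_cases hy : y = x
      · subst hy; simp
      · have : ((y, i) : Edge d L) ≠ (x, i) := fun h => hy (congrArg Prod.fst h)
        simp [this, hy]
    · intro k _ hk
      have : ((y, k) : Edge d L) ≠ (x, i) := fun h => hk (congrArg Prod.snd h)
      simp [this]
    · intro h; exact absurd (Finset.mem_univ i) h
  have h2 : ∑ k : Fin d, (Pi.single (x, i) 1 : Edge d L → ℤ) (y - Pi.single k 1, k) =
      (Pi.single (x.shift i) 1 : Site d L → ℤ) y := by
    rw [Finset.sum_eq_single i]
    · by_cases hy : y = x.shift i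
      · subst hy
        have : (x.shift i - Pi.single i 1 : Site d L) = x := by simp [Site.shift]
        simp [this]
      · have hne : (y - Pi.single i 1 : Site d L) ≠ x := by
          intro h; apply hy; rw [← h]; simp [Site.shift]
        have : ((y - Pi.single i 1, i) : Edge d L) ≠ (x, i) := fun h => hne (congrArg Prod.fst h)
        simp [this, hy]
    · intro k _ hk
      have : ((y - Pi.single k 1, k) : Edge d L) ≠ (x, i) := fun h => hk (congrArg Prod.snd h)
      simp [this]
    · intro h; exact absurd (Finset.mem_univ i) h
  rw [Finset.sum_sub_distrib, h1, h2, Pi.sub_apply]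

omit [NeZero L] in
/-- **Every signed boundary has zero divergence**: `(𝟙_x − 𝟙_{x+e_i}) + (𝟙_{x+e_i} − 𝟙_{x+e_i+e_j}) −
(𝟙_{x+e_j} − 𝟙_{x+e_j+e_i}) − (𝟙_x − 𝟙_{x+e_j}) = 0`. [ours] -/
theorem intDivergence_signedBoundary (p : Plaquette d L) :
    (fun y : Site d L => ∑ k : Fin d,
        ((Pi.single (p.1, p.2.1.1) 1 + Pi.single (p.1.shift p.2.1.1, p.2.1.2) 1 -
            Pi.single (p.1.shift p.2.1.2, p.2.1.1) 1 - Pi.single (p.1, p.2.1.2) 1 : Edge d L → ℤ) (y, k) -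
          (Pi.single (p.1, p.2.1.1) 1 + Pi.single (p.1.shift p.2.1.1, p.2.1.2) 1 -
            Pi.single (p.1.shift p.2.1.2, p.2.1.1) 1 - Pi.single (p.1, p.2.1.2) 1 : Edge d L → ℤ)
            (y - Pi.single k 1, k))) = 0 := by
  classical
  have hlin := (intDivergence_isLinear (d := d) (L := L))
  set D := hlin.mk' with hD
  have hDapp : ∀ f : Edge d L → ℤ, D f = fun y : Site d L => ∑ k : Fin d, (f (y, k) - f (y - Pi.single k 1, k)) :=
    fun f => rfl
  have hsingle : ∀ (x : Site d L) (i : Fin d), D (Pi.single (x, i) 1) =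
      (Pi.single x 1 - Pi.single (x.shift i) 1 : Site d L → ℤ) := fun x i => by
    rw [hDapp]; exact intDivergence_single x i
  rw [← hDapp, map_sub, map_sub, map_add, hsingle, hsingle, hsingle, hsingle]
  have hcomm : (p.1.shift p.2.1.1).shift p.2.1.2 = (p.1.shift p.2.1.2).shift p.2.1.1 := by
    simp only [Site.shift]; abel
  rw [hcomm]
  abel

/-- The signed winding `f ↦ (m ↦ Σ_{x : x_m = 0} f(x,m))` is `ℤ`-linear. [ours] -/
theorem intWinding_isLinear :
    IsLinearMap ℤ (fun f : Edge d L → ℤ =>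
      fun m : Fin d => ∑ x ∈ (Finset.univ.filter fun x : Site d L => x m = 0), f (x, m)) := by
  constructor
  · intro f g; ext m
    simp only [Pi.add_apply, Finset.sum_add_distrib]
  · intro c f; ext m
    simp only [Pi.smul_apply, smul_eq_mul, Finset.mul_sum]

/-- The signed winding of a single link `𝟙_{(x,i)}`: component `m` is `1` iff `m = i` and `x_i = 0`. [ours] -/
theorem intWinding_single (x : Site d L) (i m : Fin d) :
    ∑ y ∈ (Finset.univ.filter fun y : Site d L => y m = 0),
        (Pi.single (x, i) 1 : Edge d L → ℤ) (y, m) = if m = i ∧ x i = 0 then 1 else 0 := by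
  classical
  by_cases hm : m = i
  · rw [hm, if_congr (and_iff_right rfl) rfl rfl]
    by_cases hx : x i = 0
    · rw [if_pos hx, Finset.sum_eq_single x]
      · simp
      · intro y _ hy
        have : ((y, i) : Edge d L) ≠ (x, i) := fun h => hy (congrArg Prod.fst h)
        simp [this]
      · intro h; exact absurd (Finset.mem_filter.2 ⟨Finset.mem_univ x, hx⟩) h
    · rw [if_neg hx]
      refine Finset.sum_eq_zero fun y hy => ?_
      have hy' : y i = 0 := (Finset.mem_filter.1 hy).2
      have : ((y, i) : Edge d L) ≠ (x, i) := by
        intro h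
        have hyx : y = x := congrArg Prod.fst h
        exact hx (by rw [← hyx]; exact hy')
      simp [this]
  · rw [if_neg (fun h => hm h.1)]
    refine Finset.sum_eq_zero fun y _ => ?_
    have : ((y, m) : Edge d L) ≠ (x, i) := fun h => hm (congrArg Prod.snd h)
    simp [this]

/-- **Every signed boundary has zero winding**: the two direction-`i` links of `(x; i, j)` have the same `i`-th
coordinate and opposite signs, and so do the two direction-`j` links. [ours] -/
theorem intWinding_signedBoundary (p : Plaquette d L) (m : Fin d) :
    ∑ y ∈ (Finset.univ.filter fun y : Site d L => y m = 0),
        (Pi.single (p.1, p.2.1.1) 1 + Pi.single (p.1.shift p.2.1.1, p.2.1.2) 1 -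
          Pi.single (p.1.shift p.2.1.2, p.2.1.1) 1 - Pi.single (p.1, p.2.1.2) 1 : Edge d L → ℤ) (y, m) = 0 := by
  classical
  obtain ⟨x, ⟨⟨i, j⟩, hij⟩⟩ := p
  have hij' : i ≠ j := ne_of_lt hij
  simp only [Pi.add_apply, Pi.sub_apply, Finset.sum_add_distrib, Finset.sum_sub_distrib, intWinding_single]
  have h1 : (x.shift i) j = x j := by
    simp [Site.shift, Pi.single_eq_of_ne hij'.symm]
  have h2 : (x.shift j) i = x i := by
    simp [Site.shift, Pi.single_eq_of_ne hij']
  rw [h1, h2]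
  ring

omit [NeZero L] in
/-- Mod `2` the signed divergence is the vertex parity of `TorusRankedParityBound`. [ours] -/
theorem intCast_intDivergence (f : Edge d L → ℤ) (y : Site d L) :
    (((∑ i : Fin d, (f (y, i) - f (y - Pi.single i 1, i))) : ℤ) : ZMod 2) =
      ∑ i : Fin d, (((f (y, i) : ℤ) : ZMod 2) + ((f (y - Pi.single i 1, i) : ℤ) : ZMod 2)) := by
  push_cast
  simp only [sub_eq_add_neg, ZMod.neg_eq_self_mod_two]

/-- Mod `2` the signed winding is the winding of `TorusRankedHomologyBound`. [ours] -/
theorem intCast_intWinding (f : Edge d L → ℤ) (m : Fin d) :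
    (((∑ x ∈ (Finset.univ.filter fun x : Site d L => x m = 0), f (x, m)) : ℤ) : ZMod 2) =
      ∑ x ∈ (Finset.univ.filter fun x : Site d L => x m = 0), ((f (x, m) : ℤ) : ZMod 2) := by
  push_cast
  rfl

/-! ## §3 Bookkeeping: optimal structures are full -/

/-- **Optimal structures are full**: `#Bᶜ = k_min(d, L) = (d−1)(d−2)/2·L^d + (d−1)` (the least number of
plaquettes outside a ranked structure, `TorusRankedMorseCount.isLeast_card_compl_ranked`) means
`#B = (d−1)(L^d − 1)`. [ours] -/
theorem card_eq_of_card_compl_eq_kmin (B : Finset (Plaquette d L))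
    (hopt : (Finset.univ \ B).card = (d - 1) * (d - 2) / 2 * L ^ d + (d - 1)) :
    B.card = (d - 1) * (L ^ d - 1) := by
  have hP := two_mul_card_plaquette d L
  rw [Summit.Ventures.LatticeQCDFlow.Runbook.card_site] at hP
  have hc : (Finset.univ \ B).card + B.card = Fintype.card (Plaquette d L) := by
    rw [Finset.card_sdiff_add_card_eq_card (Finset.subset_univ B), Finset.card_univ]
  have hX : 1 ≤ L ^ d := Nat.one_le_pow _ _ (Nat.pos_of_ne_zero (NeZero.ne L))
  rcases Nat.lt_or_ge d 2 with hd | hd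
  · interval_cases d
    · simp only [Nat.zero_sub, zero_mul, Nat.zero_div, zero_add] at hopt hP ⊢
      omega
    · simp only [Nat.sub_self, zero_mul, Nat.zero_div, mul_zero, add_zero] at hopt hP ⊢
      omega
  · obtain ⟨e, rfl⟩ : ∃ e, d = e + 2 := ⟨d - 2, by omega⟩
    obtain ⟨Y, hY⟩ : ∃ Y, L ^ (e + 2) = Y + 1 := ⟨L ^ (e + 2) - 1, by omega⟩
    simp only [Nat.add_sub_cancel, show e + 2 - 1 = e + 1 from rfl] at hopt hP ⊢
    rw [hY] at hopt hP ⊢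
    simp only [Nat.add_sub_cancel]
    have h1 : (e + 1) * e / 2 * (Y + 1) * 2 = (e + 1) * e * (Y + 1) := by
      have := Nat.two_mul_div_two_of_even (Nat.even_mul_pred_self (e + 1))
      simp only [Nat.add_sub_cancel] at this
      nlinarith [this]
    nlinarith [hopt, hP, hc, h1]

end Summit.Ventures.LatticeQCDFlow.Theory2.Autoregressive
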